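import Summits.HodgeConjecture.CorCM.B01.Transposition.Item6CentralTypeAtPinCanonical
import Summits.HodgeConjecture.CorCM.B01.Transposition.Item6PinBlockVanishingContinuous
import Summits.HodgeConjecture.HodgeCM.Model.ToyG2.LevelExists
import Summits.HodgeConjecture.HodgeCM.Model.PerLOfCanonical
import Summits.HodgeConjecture.CorCM.Rekey.Binders.GOGConj
import HarnessLib

/-!
# The pinned dictionary's `Thm418C` is FREE at a non-canonical `ι₁` (the `h418` guard `(mk ι₁).embedding = ι₁` is a spelling)

Cell pub-hodgecm2 (COR-CM), seat pin-3 (gen 14), 2026-08-24.  Sequel of `Transposition/Item6CentralTypeAtPinCanonical` and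
`Transposition/Item6PinBlockVanishingContinuous` (GAP-READ-1 v17 §O ∕ (R3): «h418 GUARDED ⟺ h418 UNGUARDED»).

The crux family `h418` of the hM side (`PortJoin/HMDischargeLocal` :85–:96) and every END's §A demand the combined reading
`(liuDictionaryPin … V (I V (repAt a₀) (muLiu ι₁ GramClass.rep)) (line …)).Thm418C` ONLY under the guard
`hV : (InfinitePlace.mk ι₁).embedding = ι₁`.  The guard excludes nothing: at a NON-canonical `ι₁` every index line of
`I V ρ (muLiu ι₁ ρ')` has discontinuous pair splitting (`CentralTypeAtPin.not_continuous_of_embedding_mk_ne`, [GR91 §3.1] rigidity), so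
every block of the pinned dictionary is `⊥` (`BlockVanishing.block_pin_line_eq_bot_of_not_continuous`, [GR91 Prop. 3.1.1]), and the
reading `Thm418C = ∀ i, PhiMu i → ∃ K₀, ∀ K ≤ K₀, ∀ x ∈ block i, x fixed → res K x ∈ span (cmClasses K i)` is MONOTONE-VACUOUS in the
block:

* **`thm418C_liuDictionaryPin_of_embedding_mk_ne`** — `(mk ι₁).embedding ≠ ι₁ → (liuDictionaryPin … V (I V ρ (muLiu ι₁ ρ')) (line V ρ (muLiu ι₁ ρ'))).Thm418C`
  for all rows, every `V`, all sections `ρ, ρ'` of `mk` — no citation, no record, no theta supply;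
* `thm418C_liuDictionaryPin_of_forall_embedding_mk_eq` — hence a supplier of `Thm418C` UNDER the guard supplies it WITHOUT the guard
  (case split on `InfinitePlace.embedding_mk_eq ι₁`); §2 the same two at the index of record `(repAt a₀, GramClass.rep)`;
* §3 the MIRROR KEY of a presentation of record `hV : (mk ι₁).embedding = ι₁`: `Thm418C` is free over EVERY hermitian space presented at
  `ῑ₁ = conj ∘ ι₁` (`…_starRingEnd_comp`, via `SignRecipe.embedding_mk_ne_starRingEnd_comp`), in particular over stage-1's transposed space
  `V.transposeAt ῑ₁ _` (`thm418C_liuDictionaryPin_transposeAt`); and the `Iff` between the UNGUARDED `∀`-family and the guarded shape of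
  the `h418` binder at a fixed CM field (`thm418C_indexOfRecord_forall_iff_guarded`).

KERNEL only (theorems, no definition, no named fact).  HC_CM is NOT proved here or anywhere; nothing here inhabits `hLiu ∕ hM ∕ h418` at a
CANONICAL `ι₁` (there the reading is [Liu21, Thm. 4.18 + (4.3)] content); no pointer moves.
-/

set_option autoImplicit false

noncomputable section

namespace Summit.HodgeConjecture.CorCM.Transposition.CentralTypeAtPin

open NumberField NumberField.InfinitePlace
open Literature.AlgebraicGeometry.HodgeTheory Literature.NumberTheory.Automorphic.PicardCM
open Literature.NumberTheory.GelbartRogawski1991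
open Literature.NumberTheory.Transcendental (Arapura2012_Cor_15_4_6)
open HodgeCM HodgeCM.Model HodgeCM.Model.LiuIndex

variable {L : CMField} {ι₁ : (L : Type) →+* ℂ}

/-! ## §1 Any sections `ρ`, `ρ'` of `mk` -/

/-- **`Thm418C` OF THE PINNED DICTIONARY IS FREE AT A NON-CANONICAL `ι₁`.**  If `(mk ι₁).embedding ≠ ι₁` then, for all rows, every
hermitian 3-space `V` at `ι₁` and all sections `ρ, ρ'` of `mk`, the combined reading r8 `Thm418C` of
`liuDictionaryPin … V (I V ρ (muLiu ι₁ ρ')) (line V ρ (muLiu ι₁ ρ'))` HOLDS outright: every index line has discontinuous pair splitting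
(`not_continuous_of_embedding_mk_ne`), so every block is `⊥` (`BlockVanishing.block_pin_line_eq_bot_of_not_continuous`) and the clause
«`∀ x ∈ block i, … → res K x ∈ span …`» only ever sees `x = 0`.  No [Liu21] citation, no (4.3) record, no theta supply enters.
[cite: GelbartRogawski1991, §3.1 Prop. 3.1.1 p. 455 L1–3, Remark p. 457 L4–13] [cite: KonnoKonno2007, Lemma 5.2 p. 73] -/
theorem thm418C_liuDictionaryPin_of_embedding_mk_ne {hHD : exists_isReal_hodgeModel} {hI : hodgePQ_independent_of_hodgeModel}
    {h₁ : BallQuotientUniformised} {h₃ : CMAbelianVarietyRealised} {hA : Arapura2012_Cor_15_4_6}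
    (V : HermSpace3 L ι₁) (ρ ρ' : GramClass L → RealScalar L) (hρ : ∀ q, GramClass.mk (ρ q) = q) (hρ' : ∀ q, GramClass.mk (ρ' q) = q)
    (hne : (InfinitePlace.mk ι₁).embedding ≠ ι₁) :
    (liuDictionaryPin hHD hI h₁ h₃ hA V (I V ρ (muLiu ι₁ ρ')) (line V ρ (muLiu ι₁ ρ'))).Thm418C := by
  intro i _hi
  refine ⟨Classical.arbitrary (Level V), fun K _ x hx _ => ?_⟩
  rw [BlockVanishing.block_pin_line_eq_bot_of_not_continuous hHD hI h₁ h₃ hA V ρ (muLiu ι₁ ρ') i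
      (not_continuous_of_embedding_mk_ne V ρ ρ' hρ hρ' hne i), Submodule.mem_bot] at hx
  rw [hx, map_zero]
  exact Submodule.zero_mem _

/-- **`h418` GUARDED ⟺ `h418` UNGUARDED**: a supplier of the pinned dictionary's `Thm418C` under the guard `(mk ι₁).embedding = ι₁`
(the shape of the hM side's `h418` binder and of every END's §A hypothesis `hV`) supplies it with NO guard — case split on
`InfinitePlace.embedding_mk_eq ι₁`, the non-canonical case being `thm418C_liuDictionaryPin_of_embedding_mk_ne`.
[cite: GelbartRogawski1991, §3.1 Prop. 3.1.1 p. 455 L1–3, Remark p. 457 L4–13] -/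
theorem thm418C_liuDictionaryPin_of_forall_embedding_mk_eq {hHD : exists_isReal_hodgeModel} {hI : hodgePQ_independent_of_hodgeModel}
    {h₁ : BallQuotientUniformised} {h₃ : CMAbelianVarietyRealised} {hA : Arapura2012_Cor_15_4_6}
    (V : HermSpace3 L ι₁) (ρ ρ' : GramClass L → RealScalar L) (hρ : ∀ q, GramClass.mk (ρ q) = q) (hρ' : ∀ q, GramClass.mk (ρ' q) = q)
    (h : (InfinitePlace.mk ι₁).embedding = ι₁ →
      (liuDictionaryPin hHD hI h₁ h₃ hA V (I V ρ (muLiu ι₁ ρ')) (line V ρ (muLiu ι₁ ρ'))).Thm418C) :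
    (liuDictionaryPin hHD hI h₁ h₃ hA V (I V ρ (muLiu ι₁ ρ')) (line V ρ (muLiu ι₁ ρ'))).Thm418C := by
  by_cases hemb : (InfinitePlace.mk ι₁).embedding = ι₁
  · exact h hemb
  · exact thm418C_liuDictionaryPin_of_embedding_mk_ne V ρ ρ' hρ hρ' hemb

/-! ## §2 At the index of record `(repAt a₀, GramClass.rep)` — the `h418` binder's dictionary -/

/-- at the index of record: `(mk ι₁).embedding ≠ ι₁ → (liuDictionaryPin … V (I V (repAt a₀) (muLiu ι₁ GramClass.rep)) (line …)).Thm418C`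
(`thm418C_liuDictionaryPin_of_embedding_mk_ne` at the sections `repAt_spec a₀` ∕ `GramClass.mk_rep`).
[cite: GelbartRogawski1991, §3.1 Prop. 3.1.1 p. 455 L1–3, Remark p. 457 L4–13] -/
theorem thm418C_liuDictionaryPin_indexOfRecord_of_embedding_mk_ne {hHD : exists_isReal_hodgeModel}
    {hI : hodgePQ_independent_of_hodgeModel} {h₁ : BallQuotientUniformised} {h₃ : CMAbelianVarietyRealised} {hA : Arapura2012_Cor_15_4_6}
    (V : HermSpace3 L ι₁) (a₀ : RealScalar L) (hne : (InfinitePlace.mk ι₁).embedding ≠ ι₁) :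
    (liuDictionaryPin hHD hI h₁ h₃ hA V (I V (repAt a₀) (muLiu ι₁ GramClass.rep))
      (line V (repAt a₀) (muLiu ι₁ GramClass.rep))).Thm418C :=
  thm418C_liuDictionaryPin_of_embedding_mk_ne V (repAt a₀) GramClass.rep (fun q => repAt_spec a₀ q) GramClass.mk_rep hne

/-- **THE `h418` BINDER WITHOUT ITS GUARD**, at the index of record: from a supplier under `(mk ι₁).embedding = ι₁` (the literal shape
`∀ …, (mk ι₁).embedding = ι₁ → ∀ a₀, (liuDictionaryPin …).Thm418C` of `PortJoin/HMDischargeLocal`'s `h418`, read at one `(V, a₀)`) to the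
unguarded reading.  The guard is a SPELLING: it excludes only instances that are theorems.
[cite: GelbartRogawski1991, §3.1 Prop. 3.1.1 p. 455 L1–3, Remark p. 457 L4–13] -/
theorem thm418C_liuDictionaryPin_indexOfRecord_of_guarded {hHD : exists_isReal_hodgeModel}
    {hI : hodgePQ_independent_of_hodgeModel} {h₁ : BallQuotientUniformised} {h₃ : CMAbelianVarietyRealised} {hA : Arapura2012_Cor_15_4_6}
    (V : HermSpace3 L ι₁) (a₀ : RealScalar L)
    (h418 : (InfinitePlace.mk ι₁).embedding = ι₁ →
      (liuDictionaryPin hHD hI h₁ h₃ hA V (I V (repAt a₀) (muLiu ι₁ GramClass.rep))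
        (line V (repAt a₀) (muLiu ι₁ GramClass.rep))).Thm418C) :
    (liuDictionaryPin hHD hI h₁ h₃ hA V (I V (repAt a₀) (muLiu ι₁ GramClass.rep))
      (line V (repAt a₀) (muLiu ι₁ GramClass.rep))).Thm418C :=
  thm418C_liuDictionaryPin_of_forall_embedding_mk_eq V (repAt a₀) GramClass.rep (fun q => repAt_spec a₀ q) GramClass.mk_rep h418

/-! ## §3 The mirror key of a presentation of record, and «unguarded ⟺ guarded» -/

/-- `conj ∘ (conj ∘ ι₁) = ι₁` for complex embeddings (`ComplexEmbedding.conjugate` of `(starRingEnd ℂ).comp ι₁`). [folklore] -/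
theorem conjugate_starRingEnd_comp (ι : (L : Type) →+* ℂ) : ComplexEmbedding.conjugate ((starRingEnd ℂ).comp ι) = ι := by
  ext x
  simp [ComplexEmbedding.conjugate_coe_eq]

/-- **at the MIRROR KEY `ῑ₁ = conj ∘ ι₁` of a presentation of record `hV : (mk ι₁).embedding = ι₁`, `Thm418C` is free over EVERY hermitian
3-space `V'` presented at `ῑ₁`** (`(mk ῑ₁).embedding = ι₁ ≠ ῑ₁`, ✔ `SignRecipe.embedding_mk_ne_starRingEnd_comp`).
[cite: GelbartRogawski1991, §3.1 Prop. 3.1.1 p. 455 L1–3, Remark p. 457 L4–13] -/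
theorem thm418C_liuDictionaryPin_indexOfRecord_starRingEnd_comp {hHD : exists_isReal_hodgeModel}
    {hI : hodgePQ_independent_of_hodgeModel} {h₁ : BallQuotientUniformised} {h₃ : CMAbelianVarietyRealised} {hA : Arapura2012_Cor_15_4_6}
    (hV : (InfinitePlace.mk ι₁).embedding = ι₁) (V' : HermSpace3 L ((starRingEnd ℂ).comp ι₁)) (a₀ : RealScalar L) :
    (liuDictionaryPin hHD hI h₁ h₃ hA V' (I V' (repAt a₀) (muLiu ((starRingEnd ℂ).comp ι₁) GramClass.rep))
      (line V' (repAt a₀) (muLiu ((starRingEnd ℂ).comp ι₁) GramClass.rep))).Thm418C :=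
  thm418C_liuDictionaryPin_indexOfRecord_of_embedding_mk_ne V' a₀ (SignRecipe.embedding_mk_ne_starRingEnd_comp hV)

/-- **… in particular over stage-1's TRANSPOSED space `V.transposeAt ῑ₁ _`** (`HodgeCM/Model/PerLOfCanonical`: Gram matrix `Hmᵀ` presented at
`ῑ₁`, the space through which the hM side reaches the non-canonical presentations, `periodNV_face_anyEmb_R2J`): the crux reading there is a
THEOREM under `hV` — all blocks `⊥`. [cite: GelbartRogawski1991, §3.1 Prop. 3.1.1 p. 455 L1–3, Remark p. 457 L4–13] -/
theorem thm418C_liuDictionaryPin_transposeAt {hHD : exists_isReal_hodgeModel} {hI : hodgePQ_independent_of_hodgeModel}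
    {h₁ : BallQuotientUniformised} {h₃ : CMAbelianVarietyRealised} {hA : Arapura2012_Cor_15_4_6}
    (hV : (InfinitePlace.mk ι₁).embedding = ι₁) (V : HermSpace3 L ι₁) (a₀ : RealScalar L) :
    (liuDictionaryPin hHD hI h₁ h₃ hA (V.transposeAt ((starRingEnd ℂ).comp ι₁) (conjugate_starRingEnd_comp ι₁))
      (I (V.transposeAt ((starRingEnd ℂ).comp ι₁) (conjugate_starRingEnd_comp ι₁)) (repAt a₀)
        (muLiu ((starRingEnd ℂ).comp ι₁) GramClass.rep))
      (line (V.transposeAt ((starRingEnd ℂ).comp ι₁) (conjugate_starRingEnd_comp ι₁)) (repAt a₀)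
        (muLiu ((starRingEnd ℂ).comp ι₁) GramClass.rep))).Thm418C :=
  thm418C_liuDictionaryPin_indexOfRecord_starRingEnd_comp hV (V.transposeAt ((starRingEnd ℂ).comp ι₁) (conjugate_starRingEnd_comp ι₁)) a₀

/-- **«h418 UNGUARDED ⟺ h418 GUARDED»** at a fixed CM field and fixed rows: the `∀ ι₁ V a₀` family of the pinned dictionary's `Thm418C`
WITHOUT the canonical-representative clause is EQUIVALENT to the guarded family — the exact shape of the `h418` binder of
`PortJoin/HMDischargeLocal.hM_of_port_local` read at one field (`∀ {ι₁} V, (mk ι₁).embedding = ι₁ → ∀ a₀, …`).  The orientation-asymmetric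
guard is a SPELLING: it excludes exactly the instances that are theorems (`thm418C_liuDictionaryPin_indexOfRecord_of_embedding_mk_ne`).
[cite: GelbartRogawski1991, §3.1 Prop. 3.1.1 p. 455 L1–3, Remark p. 457 L4–13] -/
theorem thm418C_indexOfRecord_forall_iff_guarded {hHD : exists_isReal_hodgeModel} {hI : hodgePQ_independent_of_hodgeModel}
    {h₁ : BallQuotientUniformised} {h₃ : CMAbelianVarietyRealised} {hA : Arapura2012_Cor_15_4_6} :
    (∀ {ι₁ : (L : Type) →+* ℂ} (V : HermSpace3 L ι₁) (a₀ : RealScalar L),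
        (liuDictionaryPin hHD hI h₁ h₃ hA V (I V (repAt a₀) (muLiu ι₁ GramClass.rep))
          (line V (repAt a₀) (muLiu ι₁ GramClass.rep))).Thm418C) ↔
      (∀ {ι₁ : (L : Type) →+* ℂ} (V : HermSpace3 L ι₁), (InfinitePlace.mk ι₁).embedding = ι₁ → ∀ a₀ : RealScalar L,
        (liuDictionaryPin hHD hI h₁ h₃ hA V (I V (repAt a₀) (muLiu ι₁ GramClass.rep))
          (line V (repAt a₀) (muLiu ι₁ GramClass.rep))).Thm418C) :=
  ⟨fun h _ V _ a₀ => h V a₀, fun h _ V a₀ => thm418C_liuDictionaryPin_indexOfRecord_of_guarded V a₀ fun hV => h V hV a₀⟩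

end Summit.HodgeConjecture.CorCM.Transposition.CentralTypeAtPin

end
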